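import Summits.RiemannHypothesis.RiemannHypothesis.Theorems.SemilocalNegCertUptoHundredThirtyOneKinked
import HarnessLib

/-!
# Semi-local threshold of the `{∞} ∪ {p < 137}` form, negative side: `a*({2,…,131}) ≤ 1263/512` — the wall `q = 137` from a KINKED (piecewise-cubic) witness (part 1b/21: the atom side in 15 kernel chunks (imports part 1))

Cell `rh-explicit` (HOME `run/shared/lean/pub/rh-explicit/`), seat cc-s2-4 (A4 SEMILOCAL-TABLE, kernel column; pipeline gen11 `mkkinked.py`).
Honest framing: theorems about the tree's `weilSemilocalThreshold S`; nothing here bears on RH.  No data is trusted: every bound is a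
`decide +kernel` fact of the piecewise certificate `SemilocalPiecewiseCert.lean` (cc-s2-4 gen8).

Instance: `S = {p < 137}`, window `b = 1263/512` (last /1024 value below `(log 139)/2`), `N = 138`, 45 atoms; odd piecewise-cubic
witness with 20 slope breaks at the atom images `|b − log n|` nearest `0` (atoms `n = 11, 13, 9, 16, 17, 8, 19, 7, 23, 25, 27, 5, 29, 31, 32, 4, 37, 41, 43, 3`,
rounded to `/1024`); float finder `Re Q/‖G‖² = -2.626e-04` (no polar credit); orders `(10, 4, 8, 4, 10, 40)`, 437 `t`-pieces
(far widths ≤ 1/4); exact kernel margin `(rhs − lhs)/‖G‖² = 2.6311e-04`.  ⇒ **`a*({p < 137}) ≤ 1263/512 < (log 139)/2`**.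
The instance is split for the gate into part 1
(table, certificate, `checkMainPW`, the atom side in kernel chunks of ≤ 4 atoms via `SemilocalPiecewiseCertSplit.lean`), parts 2–8
(68 piece facts each in the FLEX layout of `SemilocalPiecewiseCertFlex.lean` (cc-s2-4 gen12, CC4-LEAN §17.2): piece `0` by `checkPiecePW`,
every far piece by `checkPieceFlex i ⟨n, m, K, m', u₀⟩` with the orders that piece needs (mean majorant degree ≈ 62 instead of 176) and a
short dyadic centre `u₀ ≤ u_K(T₀)` — same witness, same cuts, claims recomputed (`⌈exact⌉ + 1`), kernel margin `2.6309e-04`·‖G‖²; each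
fact file imports part 1 only), the Pieces part (composition) and the Final part (theorems).  Folklore throughout.
-/

set_option autoImplicit false
set_option linter.dupNamespace false  -- the mandated namespace repeats `RiemannHypothesis`
set_option Elab.async false  -- serialise the kernel facts: in parallel they exhaust the node's per-process heap (cc-s2-4 gen11, CC4-LEAN §16.10)

noncomputable section

open Complex Filter Set MeasureTheory Topology
open scoped Real

namespace Summit.RiemannHypothesis.RiemannHypothesis.Theorems.SemilocalPolyWitness

open MeasureTheory Set Finset Real
open Literature.NumberTheory.LFunctions
open Summit.RiemannHypothesis.RiemannHypothesis.Theorems.MotivicDoor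
open Summit.RiemannHypothesis.RiemannHypothesis.Theorems.MotivicDoor.SemilocalThreshold
open Summit.RiemannHypothesis.RiemannHypothesis.Theorems.MotivicDoor.SemilocalMarkov
open LQ

set_option maxHeartbeats 0 in
/-- kernel fact: atom chunk 1/15 of `certUptoHundredThirtyOneKinked` (the first 3 atoms) is at most `3391380407434`. -/
theorem check_UptoHundredThirtyOneKinked_atoms₁ :
    certUptoHundredThirtyOneKinked.atomChunkLe ((certUptoHundredThirtyOneKinked.atoms).take 3) ((certUptoHundredThirtyOneKinked.atomPiece).take 3) 3391380407434 = true := by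
  decide +kernel

set_option maxHeartbeats 0 in
/-- kernel fact: atom chunk 2/15 of `certUptoHundredThirtyOneKinked` (the next 3 atoms) is at most `3868099786981`. -/
theorem check_UptoHundredThirtyOneKinked_atoms₂ :
    certUptoHundredThirtyOneKinked.atomChunkLe (((certUptoHundredThirtyOneKinked.atoms).drop 3).take 3) (((certUptoHundredThirtyOneKinked.atomPiece).drop 3).take 3) 3868099786981 = true := by
  decide +kernel

set_option maxHeartbeats 0 in
/-- kernel fact: atom chunk 3/15 of `certUptoHundredThirtyOneKinked` (the next 3 atoms) is at most `4135441199244`. -/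
theorem check_UptoHundredThirtyOneKinked_atoms₃ :
    certUptoHundredThirtyOneKinked.atomChunkLe ((((certUptoHundredThirtyOneKinked.atoms).drop 3).drop 3).take 3) ((((certUptoHundredThirtyOneKinked.atomPiece).drop 3).drop 3).take 3) 4135441199244 = true := by
  decide +kernel

set_option maxHeartbeats 0 in
/-- kernel fact: atom chunk 4/15 of `certUptoHundredThirtyOneKinked` (the next 3 atoms) is at most `3251067038030`. -/
theorem check_UptoHundredThirtyOneKinked_atoms₄ :
    certUptoHundredThirtyOneKinked.atomChunkLe (((((certUptoHundredThirtyOneKinked.atoms).drop 3).drop 3).drop 3).take 3) (((((certUptoHundredThirtyOneKinked.atomPiece).drop 3).drop 3).drop 3).take 3) 3251067038030 = true := by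
  decide +kernel

set_option maxHeartbeats 0 in
/-- kernel fact: atom chunk 5/15 of `certUptoHundredThirtyOneKinked` (the next 3 atoms) is at most `2750807337597`. -/
theorem check_UptoHundredThirtyOneKinked_atoms₅ :
    certUptoHundredThirtyOneKinked.atomChunkLe ((((((certUptoHundredThirtyOneKinked.atoms).drop 3).drop 3).drop 3).drop 3).take 3) ((((((certUptoHundredThirtyOneKinked.atomPiece).drop 3).drop 3).drop 3).drop 3).take 3) 2750807337597 = true := by
  decide +kernel

set_option maxHeartbeats 0 in
/-- kernel fact: atom chunk 6/15 of `certUptoHundredThirtyOneKinked` (the next 3 atoms) is at most `3199402326751`. -/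
theorem check_UptoHundredThirtyOneKinked_atoms₆ :
    certUptoHundredThirtyOneKinked.atomChunkLe (((((((certUptoHundredThirtyOneKinked.atoms).drop 3).drop 3).drop 3).drop 3).drop 3).take 3) (((((((certUptoHundredThirtyOneKinked.atomPiece).drop 3).drop 3).drop 3).drop 3).drop 3).take 3) 3199402326751 = true := by
  decide +kernel

set_option maxHeartbeats 0 in
/-- kernel fact: atom chunk 7/15 of `certUptoHundredThirtyOneKinked` (the next 3 atoms) is at most `2907604759571`. -/
theorem check_UptoHundredThirtyOneKinked_atoms₇ :
    certUptoHundredThirtyOneKinked.atomChunkLe ((((((((certUptoHundredThirtyOneKinked.atoms).drop 3).drop 3).drop 3).drop 3).drop 3).drop 3).take 3) ((((((((certUptoHundredThirtyOneKinked.atomPiece).drop 3).drop 3).drop 3).drop 3).drop 3).drop 3).take 3) 2907604759571 = true := by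
  decide +kernel

set_option maxHeartbeats 0 in
/-- kernel fact: atom chunk 8/15 of `certUptoHundredThirtyOneKinked` (the next 3 atoms) is at most `1646434787378`. -/
theorem check_UptoHundredThirtyOneKinked_atoms₈ :
    certUptoHundredThirtyOneKinked.atomChunkLe (((((((((certUptoHundredThirtyOneKinked.atoms).drop 3).drop 3).drop 3).drop 3).drop 3).drop 3).drop 3).take 3) (((((((((certUptoHundredThirtyOneKinked.atomPiece).drop 3).drop 3).drop 3).drop 3).drop 3).drop 3).drop 3).take 3) 1646434787378 = true := by
  decide +kernel

set_option maxHeartbeats 0 in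
/-- kernel fact: atom chunk 9/15 of `certUptoHundredThirtyOneKinked` (the next 3 atoms) is at most `1764264287075`. -/
theorem check_UptoHundredThirtyOneKinked_atoms₉ :
    certUptoHundredThirtyOneKinked.atomChunkLe ((((((((((certUptoHundredThirtyOneKinked.atoms).drop 3).drop 3).drop 3).drop 3).drop 3).drop 3).drop 3).drop 3).take 3) ((((((((((certUptoHundredThirtyOneKinked.atomPiece).drop 3).drop 3).drop 3).drop 3).drop 3).drop 3).drop 3).drop 3).take 3) 1764264287075 = true := by
  decide +kernel

set_option maxHeartbeats 0 in
/-- kernel fact: atom chunk 10/15 of `certUptoHundredThirtyOneKinked` (the next 3 atoms) is at most `3095989851107`. -/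
theorem check_UptoHundredThirtyOneKinked_atoms₁₀ :
    certUptoHundredThirtyOneKinked.atomChunkLe (((((((((((certUptoHundredThirtyOneKinked.atoms).drop 3).drop 3).drop 3).drop 3).drop 3).drop 3).drop 3).drop 3).drop 3).take 3) (((((((((((certUptoHundredThirtyOneKinked.atomPiece).drop 3).drop 3).drop 3).drop 3).drop 3).drop 3).drop 3).drop 3).drop 3).take 3) 3095989851107 = true := by
  decide +kernel

set_option maxHeartbeats 0 in
/-- kernel fact: atom chunk 11/15 of `certUptoHundredThirtyOneKinked` (the next 3 atoms) is at most `2602037524850`. -/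
theorem check_UptoHundredThirtyOneKinked_atoms₁₁ :
    certUptoHundredThirtyOneKinked.atomChunkLe ((((((((((((certUptoHundredThirtyOneKinked.atoms).drop 3).drop 3).drop 3).drop 3).drop 3).drop 3).drop 3).drop 3).drop 3).drop 3).take 3) ((((((((((((certUptoHundredThirtyOneKinked.atomPiece).drop 3).drop 3).drop 3).drop 3).drop 3).drop 3).drop 3).drop 3).drop 3).drop 3).take 3) 2602037524850 = true := by
  decide +kernel

set_option maxHeartbeats 0 in
/-- kernel fact: atom chunk 12/15 of `certUptoHundredThirtyOneKinked` (the next 3 atoms) is at most `3431014217863`. -/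
theorem check_UptoHundredThirtyOneKinked_atoms₁₂ :
    certUptoHundredThirtyOneKinked.atomChunkLe (((((((((((((certUptoHundredThirtyOneKinked.atoms).drop 3).drop 3).drop 3).drop 3).drop 3).drop 3).drop 3).drop 3).drop 3).drop 3).drop 3).take 3) (((((((((((((certUptoHundredThirtyOneKinked.atomPiece).drop 3).drop 3).drop 3).drop 3).drop 3).drop 3).drop 3).drop 3).drop 3).drop 3).drop 3).take 3) 3431014217863 = true := by
  decide +kernel

set_option maxHeartbeats 0 in
/-- kernel fact: atom chunk 13/15 of `certUptoHundredThirtyOneKinked` (the next 3 atoms) is at most `3225790313928`. -/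
theorem check_UptoHundredThirtyOneKinked_atoms₁₃ :
    certUptoHundredThirtyOneKinked.atomChunkLe ((((((((((((((certUptoHundredThirtyOneKinked.atoms).drop 3).drop 3).drop 3).drop 3).drop 3).drop 3).drop 3).drop 3).drop 3).drop 3).drop 3).drop 3).take 3) ((((((((((((((certUptoHundredThirtyOneKinked.atomPiece).drop 3).drop 3).drop 3).drop 3).drop 3).drop 3).drop 3).drop 3).drop 3).drop 3).drop 3).drop 3).take 3) 3225790313928 = true := by
  decide +kernel

set_option maxHeartbeats 0 in
/-- kernel fact: atom chunk 14/15 of `certUptoHundredThirtyOneKinked` (the next 3 atoms) is at most `1814796657701`. -/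
theorem check_UptoHundredThirtyOneKinked_atoms₁₄ :
    certUptoHundredThirtyOneKinked.atomChunkLe (((((((((((((((certUptoHundredThirtyOneKinked.atoms).drop 3).drop 3).drop 3).drop 3).drop 3).drop 3).drop 3).drop 3).drop 3).drop 3).drop 3).drop 3).drop 3).take 3) (((((((((((((((certUptoHundredThirtyOneKinked.atomPiece).drop 3).drop 3).drop 3).drop 3).drop 3).drop 3).drop 3).drop 3).drop 3).drop 3).drop 3).drop 3).drop 3).take 3) 1814796657701 = true := by
  decide +kernel

set_option maxHeartbeats 0 in
/-- kernel fact: atom chunk 15/15 of `certUptoHundredThirtyOneKinked` (the last 3 atoms) is at most `1957974678592`. -/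
theorem check_UptoHundredThirtyOneKinked_atoms₁₅ :
    certUptoHundredThirtyOneKinked.atomChunkLe (((((((((((((((certUptoHundredThirtyOneKinked.atoms).drop 3).drop 3).drop 3).drop 3).drop 3).drop 3).drop 3).drop 3).drop 3).drop 3).drop 3).drop 3).drop 3).drop 3) (((((((((((((((certUptoHundredThirtyOneKinked.atomPiece).drop 3).drop 3).drop 3).drop 3).drop 3).drop 3).drop 3).drop 3).drop 3).drop 3).drop 3).drop 3).drop 3).drop 3) 1957974678592 = true := by
  decide +kernel

/-- the atom side of `certUptoHundredThirtyOneKinked`: the 15 kernel chunks recombined (`atomChunkLe_append`, `checkAtomsPW_of_atomChunkLe`; elaborator only). -/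
theorem check_UptoHundredThirtyOneKinked_atoms : certUptoHundredThirtyOneKinked.checkAtomsPW = true := by
  have c14 := certUptoHundredThirtyOneKinked.atomChunkLe_append _ _ _ _ _ _ (by decide) check_UptoHundredThirtyOneKinked_atoms₁₄ check_UptoHundredThirtyOneKinked_atoms₁₅
  rw [List.take_append_drop, List.take_append_drop] at c14
  have c13 := certUptoHundredThirtyOneKinked.atomChunkLe_append _ _ _ _ _ _ (by decide) check_UptoHundredThirtyOneKinked_atoms₁₃ c14
  rw [List.take_append_drop, List.take_append_drop] at c13
  have c12 := certUptoHundredThirtyOneKinked.atomChunkLe_append _ _ _ _ _ _ (by decide) check_UptoHundredThirtyOneKinked_atoms₁₂ c13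
  rw [List.take_append_drop, List.take_append_drop] at c12
  have c11 := certUptoHundredThirtyOneKinked.atomChunkLe_append _ _ _ _ _ _ (by decide) check_UptoHundredThirtyOneKinked_atoms₁₁ c12
  rw [List.take_append_drop, List.take_append_drop] at c11
  have c10 := certUptoHundredThirtyOneKinked.atomChunkLe_append _ _ _ _ _ _ (by decide) check_UptoHundredThirtyOneKinked_atoms₁₀ c11
  rw [List.take_append_drop, List.take_append_drop] at c10
  have c9 := certUptoHundredThirtyOneKinked.atomChunkLe_append _ _ _ _ _ _ (by decide) check_UptoHundredThirtyOneKinked_atoms₉ c10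
  rw [List.take_append_drop, List.take_append_drop] at c9
  have c8 := certUptoHundredThirtyOneKinked.atomChunkLe_append _ _ _ _ _ _ (by decide) check_UptoHundredThirtyOneKinked_atoms₈ c9
  rw [List.take_append_drop, List.take_append_drop] at c8
  have c7 := certUptoHundredThirtyOneKinked.atomChunkLe_append _ _ _ _ _ _ (by decide) check_UptoHundredThirtyOneKinked_atoms₇ c8
  rw [List.take_append_drop, List.take_append_drop] at c7
  have c6 := certUptoHundredThirtyOneKinked.atomChunkLe_append _ _ _ _ _ _ (by decide) check_UptoHundredThirtyOneKinked_atoms₆ c7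
  rw [List.take_append_drop, List.take_append_drop] at c6
  have c5 := certUptoHundredThirtyOneKinked.atomChunkLe_append _ _ _ _ _ _ (by decide) check_UptoHundredThirtyOneKinked_atoms₅ c6
  rw [List.take_append_drop, List.take_append_drop] at c5
  have c4 := certUptoHundredThirtyOneKinked.atomChunkLe_append _ _ _ _ _ _ (by decide) check_UptoHundredThirtyOneKinked_atoms₄ c5
  rw [List.take_append_drop, List.take_append_drop] at c4
  have c3 := certUptoHundredThirtyOneKinked.atomChunkLe_append _ _ _ _ _ _ (by decide) check_UptoHundredThirtyOneKinked_atoms₃ c4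
  rw [List.take_append_drop, List.take_append_drop] at c3
  have c2 := certUptoHundredThirtyOneKinked.atomChunkLe_append _ _ _ _ _ _ (by decide) check_UptoHundredThirtyOneKinked_atoms₂ c3
  rw [List.take_append_drop, List.take_append_drop] at c2
  have c1 := certUptoHundredThirtyOneKinked.atomChunkLe_append _ _ _ _ _ _ (by decide) check_UptoHundredThirtyOneKinked_atoms₁ c2
  rw [List.take_append_drop, List.take_append_drop] at c1
  exact certUptoHundredThirtyOneKinked.checkAtomsPW_of_atomChunkLe _ c1 (by norm_num [certUptoHundredThirtyOneKinked])

end Summit.RiemannHypothesis.RiemannHypothesis.Theorems.SemilocalPolyWitness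

end
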